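import Summits.HodgeConjecture.HodgeConjecture.Theorems.Ring2AbelianAllFrameCrossBranch
import Literature.AlgebraicGeometry.HodgeTheory.GeneralHodgeCMTypeOfCodimTwo
import HarnessLib

/-!
# Ring 2 · route `deform`, XIV — FRAME ROWS: every node of the deformation axis placed BY NAME in the LEAD's
# grammar (`ClosesWithCM` / `OnPathAV` / `ExactWithCM` / `CMIdle` / `ModCM` / `PivotAV`), the two Mumford–Tate-branch
# nodes the frame did not yet carry (IC_MT, the localised form `∀ A, CMSpreadingAt A` of U), three NEW
# unconditional kernel edges (`IC_MT ⟹ H4`, hence `(1) ⟹ H4`; `IC_MT ⟹ S_ZD` granted AO⁺), the `CMIdle` bit of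
# the CM-localised pencil nodes (3)/(R631) modulo the junction `J₂₂⁺`, and the binder `HC_CM` itself cut down
# to codimension two (Hazama's record)

HONEST FRAMING: research route conditional on HC_CM; not a corollary; Q11.4-sentence-2 already refuted in dim ≥ 3.

Cell `pub-hodge-ring2`, seat `pub-hodge-ring2-deform` (gen 18), answering the LEAD's frame call (INBOX
2026-08-19T21:34Z: "for a NEW candidate B land three one-liners BY NAME in your own file"). `HC_CM` =
`Theses.RankFourFaces.CMAbelianHodge` (stmt-HodgeConjecture-3052) is a BINDER (`hCM`, or hidden inside the
grammar words, which are implications FROM it) and never a fact; `HC_AV` = `Theses.PadicSemiregularLift.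
HodgeAbelianVarieties` (stmt-1333); the reduction item `Theses.RankFourFaces.CMToAbelian` (stmt-HodgeConjecture-16267)
is OPEN and nothing here closes it. Printed inputs enter as the literature seat's named facts, always as
binders: `hF : deligne1982_cmDenseMumfordTateFamilies` (Deligne 1982 Prop. 6.1 = Charles–Schnell Thm. 11.5.11),
`h₁₄ : deligne1982_exists_cmAnchoredHodgeFamily` (one CM fibre), `h₂₁ : andre1996_cmAnchoredPencil` (Lemme 6.3.1),
`h𝔄 : Andre1992_…` (André 1992), `hD : deligne1982_weilFamily_hodgeWeilSection_all` (LNM 900 Thm. 4.8),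
`h83 : Hazama2003_generalHodge_cmType_of_hodge_codimTwo` (Hazama 2003 Thm. 8.3). Typed OPEN inputs of other
seats used as hypotheses: spread-1's AO⁺ `ZariskiDenseCMLocusIsDense` and `DA_q`/`DA_K`
`DenselyAnchoredWeilFamilies{ImaginaryQuadratic,CMField}`, hweil's R3anc `AnchoredWeilFamiliesCMField`, and the
displayed junction `J₂₂⁺` of part VI (André's Lemmes 6.3.2–6.3.3 with two printed clauses retained; restated
below VERBATIM as the type of the binder `h₂₂`, never a fact). No `def` and no notation is introduced (IC_MT and
`J₂₂⁺` are DISPLAYED `Prop`s, written inline). Nothing here is a new case of the Hodge conjecture.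

## The deformation axis in the grammar — cross-walk BY NAME (rows of parts I–XIII and of this part)

MUMFORD–TATE-FAMILY branch (quasi-projective bases, dense CM locus; Deligne 1982 Prop. 6.1):

| node (decl) | `ClosesWithCM` | `OnPathAV` | `ExactWithCM` / `ModCM · ↔ CMToAbelian` | `CMIdle` (kernel) |
|---|---|---|---|---|
| (1) `Hypotheses.AbelianSchemeVHC` | mod `h₁₄` or `hF` (§A, via III) ; mod `h₂₁` (frame I) | yes (frame I) | mod `h₁₄` (§A = III `HC_AV_iff_HC_CM_and_abelianSchemeVHC_of_deligne1982`) | YES three ways: mod `h₂₁`+fact 22 (frame I); mod `hF h𝔄 DA_q DA_K` (spread III); mod `h𝔄 hD R3anc h₁₄` (§A, = III row M) |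
| IC_MT (Grothendieck (1.1) on the printed CM-dense families; III, inline) | mod `hF` (§A) | yes (§A) | mod `hF` (§A = III) | in PRINT yes (Abdulali Thm. 6.1 (a)); KERNEL: yes mod AO⁺ `hF h𝔄 DA_q DA_K` (§B, NEW) |
| H4 `AlgebraicityLocusClosedOnCMDenseFamilies` (II-b) | mod `hF` (spread III) | yes (spread III) | mod `hF` (spread III) | not known |
| S_ZD, U_Z (spread-1) | mod `hF` (frame II) | yes | mod `hF` | S_ZD yes mod `hF h𝔄 DA_q DA_K` (spread III); U_Z not known |
| U `UniformAlgebraicityAtCMPoints` (II-b) ≡ `∀ A, CMSpreadingAt A` (VII; §A) | mod `hF` (frame II; §A) | yes | mod `hF` | not known — premise at ALL CM fibres |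

Kernel Hasse diagram of the branch after this part (every arrow a landed theorem, unconditional unless marked):
`(1) ⟹ IC_MT ⟹ H4 ⟹ U ⟺ (∀ A, CMSpreadingAt A)`, `(1) ⟹ S_ZD ⟹ U_Z ⟹ U`, `IC_MT ⟹[AO⁺] S_ZD`, `U ⟹[AO⁺] U_Z`
(spread I); modulo `HC_CM` ALONE (no print): `IC_MT ⟺ H4 ⟺ U` (§B; sharpens spread III's collapse, which needed
`hF`); modulo `HC_CM ∧ hF`: every node of the table is `HC_AV` (frame I `iff_of_exactWithCM_of_HC_CM`).
PIVOT tier (frame III `PivotAV B := CMIdle B ∧ OnPathAV B`): IC_MT joins it granted AO⁺ on top of S_ZD's inputs, and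
(3)/(R631) join it granted `h₂₁ ∧ J₂₂⁺` (§P) — so under those inputs frame III's complement tier shrinks to
{(4), (T∃), CPS_CM, CPS_∃, U_Z, U, H4, R∞, R3, item}; by frame III `iff_of_pivotAV` any two pivots are then ONE
statement with no `HC_CM` (e.g. `IC_MT ↔ S_ZD ↔ (1)` granted AO⁺ `hF h𝔄 DA_q DA_K`; `(3) ↔ (2) ↔ (1)` granted `h₂₁ ∧ J₂₂⁺`).

PENCIL branch (compact one-dimensional bases with a section; André 1996 §6.3) — rows all in frame I/II except the
`CMIdle` column of the CM-localised nodes, supplied here (§C) from part VI's domination theorem: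

| node | `CMIdle` (kernel) |
|---|---|
| (2) `CompactAbelianPencilVHC` (IV) | yes mod `h₂₁` + fact 22 (frame I `cmIdle_blanket_of_andre1996`) |
| (3) `CMPointedCompactPencilVHC` (VI) ≡ `AbelianAll.CMPointedPencilVHC` (COUNT ONCE), (R631) `CMAnchoredPencilVHC` (VI) | **yes mod `h₂₁ ∧ J₂₂⁺`** (§C; `J₂₂⁺` refines fact 22, VI `andre1996_fact22_of_junction`) |
| (4) `AbelianAll.CMAnchoredTransport`, (T∃) | only mod the CM-anchored junction J₂₂^{CM} (sub-cell ab-andre; not typed here) |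
| CPS_CM `CMPointedPencilCMSpreading`, CPS_∃ `CMAnchoredPencilCMSpreading` (XIII) | NOT known, kernel or print (XIII `cmPointedPencilCMSpreading_iff_offCM`: CM-spreading never concludes at a CM fibre) |

ARITHMETIC axis (part V, `HodgeConjectureQbarAV`): its endpoint is Hodge over `ℚ̄`, not `HC_AV`; the grammar does not apply.

References (bib keys): Deligne1982HodgeCycles (Prop. 6.1, Thm. 2.12, Thm. 4.8); CharlesSchnell2014Notes (Conj.
11.3.1, Cor. 11.3.6, Prop. 11.3.11, Thm. 11.5.11); Abdulali1994FamiliesAV ((1.1), Lemma 6.2, Thm. 6.1 (a));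
Andre1996Motifs (Lemmes 6.3.1–6.3.3, Remarque 2); Andre1992HodgeCM; Milne2020HodgeClassesAV (Rem. 2–3);
Hazama2003GHCCM (Thm. 8.3); Pila2022 (Conj. 6.4, Thm. 6.6); CattaniDeligneKaplan1995 (Thm. 1.1).
-/

noncomputable section

set_option linter.dupNamespace false

namespace Summit.HodgeConjecture.HodgeConjecture.Ring2.Deform

open CategoryTheory AlgebraicGeometry
open Literature.AlgebraicGeometry Literature.AlgebraicGeometry.Motives
open Literature.AlgebraicGeometry.HodgeTheory
open Literature.AlgebraicGeometry.Milne1999 (IsOfCMType)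
open Literature.AlgebraicGeometry.Abdulali1994 (deligne1982_exists_cmAnchoredHodgeFamily InvariantCyclesHoldFor)
open Literature.AlgebraicGeometry.Deligne1982 (deligne1982_cmDenseMumfordTateFamilies IsCMDenseMumfordTateFamilyFor)
open Literature.AlgebraicGeometry.Andre1996 (andre1996_cmAnchoredPencil IsAlgebraicallyAnchoredPencilFor)
open Summit.HodgeConjecture.HodgeConjecture
open Summit.HodgeConjecture.HodgeConjecture.WeilTypeLadder (AnchoredWeilFamiliesCMField)
open Summit.HodgeConjecture.HodgeConjecture.Theses
open Summit.HodgeConjecture.HodgeConjecture.Theses.RankFourFaces (CMAbelianHodge CMToAbelian)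
open Summit.HodgeConjecture.HodgeConjecture.Theses.PadicSemiregularLift (HodgeAbelianVarieties)
open Summit.HodgeConjecture.HodgeConjecture.Ring2.Hypotheses (AbelianSchemeVHC)
open Summit.HodgeConjecture.HodgeConjecture.Ring2.AbelianAll (ClosesWithCM OnPathAV ExactWithCM CMIdle ModCM PivotAV
  closesWithCM_antitone cmIdle_antitone exactWithCM_iff cmToAbelian_of_closesWithCM
  modCM_iff_cmToAbelian_of_exactWithCM of_onPathAV_of_hodgeConjecture SpreadFromZariskiDenseCMPoints
  ZariskiDenseCMLocusIsDense DenselyAnchoredWeilFamiliesImaginaryQuadratic DenselyAnchoredWeilFamiliesCMField)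

/-! IC_MT below = Grothendieck's invariant-cycles statement (1.1) on every family satisfying the printed predicate
`IsCMDenseMumfordTateFamilyFor A p c`, DISPLAYED INLINE exactly as in part III (no `def`, no notation):
`∀ A p c 𝒳 S f, IsCMDenseMumfordTateFamilyFor A p c f → InvariantCyclesHoldFor f A.dim`.
[cite: Abdulali1994FamiliesAV, (1.1) (p. 1122) and Lemma 6.2 (p. 1131)] -/

/-! ## §A The Mumford–Tate-branch nodes of the deformation axis not yet in the frame: the three one-liners each -/

/-- IC_MT closes with `HC_CM`, mod Deligne's family fact (III `HC_AV_of_deligne1982_of_HC_CM_of_invariantCyclesOnMTFamilies`).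
[cite: Abdulali1994FamiliesAV, Lemma 6.2 (p. 1131)] [cite: CharlesSchnell2014Notes, Thm. 11.5.11] -/
theorem closesWithCM_invariantCyclesOnMTFamilies_of_deligne1982 (hF : deligne1982_cmDenseMumfordTateFamilies) :
    ClosesWithCM
      (∀ (A : AbelianVariety ℂ) (p : ℕ) (c : complexBetti A.X (2 * p)) (𝒳 S : SchemeOver ℂ) (f : 𝒳 ⟶ S),
        IsCMDenseMumfordTateFamilyFor A p c f → InvariantCyclesHoldFor f A.dim) :=
  fun hCM hIC ↦ HC_AV_of_deligne1982_of_HC_CM_of_invariantCyclesOnMTFamilies hF hCM hIC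

/-- IC_MT is on-path (no fact). [cite: CharlesSchnell2014Notes, Cor. 11.3.6 (p. 494)] -/
theorem onPathAV_invariantCyclesOnMTFamilies :
    OnPathAV
      (∀ (A : AbelianVariety ℂ) (p : ℕ) (c : complexBetti A.X (2 * p)) (𝒳 S : SchemeOver ℂ) (f : 𝒳 ⟶ S),
        IsCMDenseMumfordTateFamilyFor A p c f → InvariantCyclesHoldFor f A.dim) :=
  fun h ↦ invariantCyclesOnMTFamilies_of_HC_AV h

/-- IC_MT is an exact complement of `HC_CM` mod `hF`, and relativised it IS the item: `ModCM IC_MT ↔ CMToAbelian`.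
[cite: Abdulali1994FamiliesAV, Lemma 6.2 and Thm. 6.1 (a)] [cite: CharlesSchnell2014Notes, Thm. 11.5.11] -/
theorem exactWithCM_invariantCyclesOnMTFamilies_of_deligne1982 (hF : deligne1982_cmDenseMumfordTateFamilies) :
    ExactWithCM
        (∀ (A : AbelianVariety ℂ) (p : ℕ) (c : complexBetti A.X (2 * p)) (𝒳 S : SchemeOver ℂ) (f : 𝒳 ⟶ S),
          IsCMDenseMumfordTateFamilyFor A p c f → InvariantCyclesHoldFor f A.dim) ∧
      (ModCM
        (∀ (A : AbelianVariety ℂ) (p : ℕ) (c : complexBetti A.X (2 * p)) (𝒳 S : SchemeOver ℂ) (f : 𝒳 ⟶ S),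
          IsCMDenseMumfordTateFamilyFor A p c f → InvariantCyclesHoldFor f A.dim) ↔ CMToAbelian) :=
  ⟨HC_AV_iff_HC_CM_and_invariantCyclesOnMTFamilies_of_deligne1982 hF,
    modCM_iff_cmToAbelian_of_exactWithCM (HC_AV_iff_HC_CM_and_invariantCyclesOnMTFamilies_of_deligne1982 hF)⟩

/-- The LOCALISED form of U (VII: `U ↔ ∀ A, CMSpreadingAt A`, no hypothesis) closes with `HC_CM` mod `hF`.
[cite: Deligne1982HodgeCycles, §6 Prop. 6.1] [cite: CharlesSchnell2014Notes, Thm. 11.5.11 and Prop. 11.3.11] -/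
theorem closesWithCM_forall_cmSpreadingAt_of_deligne1982 (hF : deligne1982_cmDenseMumfordTateFamilies) :
    ClosesWithCM (∀ A : AbelianVariety ℂ, CMSpreadingAt A) :=
  fun hCM h ↦ (HC_AV_iff_HC_CM_and_forall_cmSpreadingAt hF).2 ⟨hCM, h⟩

/-- `∀ A, CMSpreadingAt A` is on-path (no fact: `HC(A)` makes every chart of `A` an anchor fibre). [cite: Deligne2000, §1] -/
theorem onPathAV_forall_cmSpreadingAt : OnPathAV (∀ A : AbelianVariety ℂ, CMSpreadingAt A) :=
  fun h A ↦ cmSpreadingAt_of_hodgeConjectureFor (h A)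

/-- `∀ A, CMSpreadingAt A` is exact mod `hF` (VII `HC_AV_iff_HC_CM_and_forall_cmSpreadingAt`); relativised it is
the item. [cite: Deligne1982HodgeCycles, §6 Prop. 6.1] [cite: CharlesSchnell2014Notes, Thm. 11.5.11] -/
theorem exactWithCM_forall_cmSpreadingAt_of_deligne1982 (hF : deligne1982_cmDenseMumfordTateFamilies) :
    ExactWithCM (∀ A : AbelianVariety ℂ, CMSpreadingAt A) ∧
      (ModCM (∀ A : AbelianVariety ℂ, CMSpreadingAt A) ↔ CMToAbelian) :=
  have h : ExactWithCM (∀ A : AbelianVariety ℂ, CMSpreadingAt A) := HC_AV_iff_HC_CM_and_forall_cmSpreadingAt hF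
  ⟨h, modCM_iff_cmToAbelian_of_exactWithCM h⟩

/-- (1) closes with `HC_CM`, PRINT-BACKED two ways: mod `h₁₄` (one CM-anchored Hodge family, III row V) or mod
`hF` (the CM-dense family, III `mumfordTateCMAnchors_of_deligne1982`) — the frame's row
`closesWithCM_abelianSchemeVHC_of_mumfordTate` with its typed anchor hypothesis discharged to Deligne Prop. 6.1.
[cite: Deligne1982HodgeCycles, Prop. 6.1] [cite: CharlesSchnell2014Notes, Conj. 11.3.1 and Thm. 11.5.11] -/
theorem closesWithCM_abelianSchemeVHC_of_deligne1982 :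
    (deligne1982_exists_cmAnchoredHodgeFamily → ClosesWithCM AbelianSchemeVHC) ∧
      (deligne1982_cmDenseMumfordTateFamilies → ClosesWithCM AbelianSchemeVHC) :=
  ⟨fun h₁₄ hCM hV ↦ HC_AV_of_deligne1982_of_HC_CM_of_abelianSchemeVHC h₁₄ hCM hV,
    fun hF ↦ AbelianAll.closesWithCM_abelianSchemeVHC_of_mumfordTate (mumfordTateCMAnchors_of_deligne1982 hF)⟩

/-- (1) is exact mod `h₁₄` (III), and relativised it is the item (III `cmToAbelian_iff_HC_CM_imp_abelianSchemeVHC`,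
re-derived through the grammar). [cite: Deligne1982HodgeCycles, Prop. 6.1] [cite: CharlesSchnell2014Notes, Cor. 11.3.6] -/
theorem exactWithCM_abelianSchemeVHC_of_deligne1982 (h₁₄ : deligne1982_exists_cmAnchoredHodgeFamily) :
    ExactWithCM AbelianSchemeVHC ∧ (ModCM AbelianSchemeVHC ↔ CMToAbelian) :=
  have h : ExactWithCM AbelianSchemeVHC := HC_AV_iff_HC_CM_and_abelianSchemeVHC_of_deligne1982 h₁₄
  ⟨h, modCM_iff_cmToAbelian_of_exactWithCM h⟩

/-- A THIRD kernel path to `CMIdle (1)` (Milne's endnote 19; III row M): mod André 1992, Deligne's tensor-anchored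
Weil families, hweil's OPEN anchored leaf R3anc and `h₁₄` — next to frame I's path (Lemmes 6.3.1–6.3.3) and
spread III's (Zariski-dense CM anchors). [cite: Deligne1982HodgeCycles, Milne 2003 re-edition endnote 19]
[cite: Andre1992HodgeCM] [cite: Abdulali1994FamiliesAV, Thm. 6.1 (a)] -/
theorem cmIdle_abelianSchemeVHC_of_milne
    (h𝔄 : Andre1992_hodgeClasses_cmAbelianVariety_mem_span_pullback_weilClasses)
    (hD : deligne1982_weilFamily_hodgeWeilSection_all) (hanc : AnchoredWeilFamiliesCMField)
    (h₁₄ : deligne1982_exists_cmAnchoredHodgeFamily) : CMIdle AbelianSchemeVHC :=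
  fun hV ↦ HC_AV_of_abelianSchemeVHC_of_deligne1982 h𝔄 hD hanc h₁₄ hV

/-! ## §B Three NEW unconditional edges of the Mumford–Tate branch, and what they change in the table -/

/-- **IC_MT ⟹ H4, unconditionally (no `HC_CM`, no print).** On a family in H4's scope the algebraicity locus of a
fibrewise-Hodge global class `W` is EMPTY or ALL of `S(ℂ)`: if it contains `t₀`, the chart `A' ≅ 𝒳_{t₀}` makes
the family a printed one for `(A', e'^*W|_{t₀})` (`IsCMDenseMumfordTateFamilyFor`; its anchor point is arbitrary),
and IC_MT spreads algebraicity from `t₀` to every fibre. Either way the locus is closed. Hence the finite-strata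
node H4 sits BETWEEN IC_MT and U (`(1) ⟹ IC_MT ⟹ H4 ⟹ U`), and `(1) ⟹ H4` — claimed nowhere before
(spread III lists `U ⟹ H4` as open; that converse stays open). [cite: Abdulali1994FamiliesAV, (1.1) (p. 1122)]
[cite: CharlesSchnell2014Notes, Prop. 11.3.11] -/
theorem algebraicityLocusClosedOnCMDenseFamilies_of_invariantCyclesOnMTFamilies
    (hIC : (∀ (A : AbelianVariety ℂ) (p : ℕ) (c : complexBetti A.X (2 * p)) (𝒳 S : SchemeOver ℂ) (f : 𝒳 ⟶ S),
      IsCMDenseMumfordTateFamilyFor A p c f → InvariantCyclesHoldFor f A.dim)) :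
    AlgebraicityLocusClosedOnCMDenseFamilies := by
  intro n 𝒳 S f hf h𝒳 hS hirr hsm hab hD p W hW
  by_cases hne : ∃ t₀ : ComplexPoints S,
      complexBetti.map (fiberι f t₀) (2 * p) W ∈ algebraicClasses (fiberOver f t₀) p
  · obtain ⟨t₀, ht₀⟩ := hne
    obtain ⟨A', hdim', ⟨e'⟩⟩ := hab t₀
    subst hdim'
    have hfam : IsCMDenseMumfordTateFamilyFor A' p
        (complexBetti.map e'.hom (2 * p) (complexBetti.map (fiberι f t₀) (2 * p) W)) f :=
      ⟨t₀, e', W, hf, h𝒳, hS, hirr, hsm, hab, hW, rfl, hD⟩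
    have hall := hIC A' p _ 𝒳 S f hfam p W hW ⟨t₀, ht₀⟩
    have huniv : {t : ComplexPoints S |
        complexBetti.map (fiberι f t) (2 * p) W ∈ algebraicClasses (fiberOver f t) p} = Set.univ :=
      Set.eq_univ_of_forall hall
    rw [huniv]
    exact isClosed_univ
  · have hempty : {t : ComplexPoints S |
        complexBetti.map (fiberι f t) (2 * p) W ∈ algebraicClasses (fiberOver f t) p} = ∅ :=
      Set.subset_empty_iff.1 fun t ht ↦ hne ⟨t, ht⟩
    rw [hempty]
    exact isClosed_empty

/-- Hence **(1) `AbelianSchemeVHC ⟹ H4`** (through III `invariantCyclesOnMTFamilies_of_abelianSchemeVHC`).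
[cite: CharlesSchnell2014Notes, Conj. 11.3.1 and Prop. 11.3.11] -/
theorem algebraicityLocusClosedOnCMDenseFamilies_of_abelianSchemeVHC (hV : AbelianSchemeVHC) :
    AlgebraicityLocusClosedOnCMDenseFamilies :=
  algebraicityLocusClosedOnCMDenseFamilies_of_invariantCyclesOnMTFamilies
    (invariantCyclesOnMTFamilies_of_abelianSchemeVHC hV)

/-- **IC_MT ⟹ S_ZD granted spread-1's André–Oort-shaped upgrade AO⁺** (`ZariskiDenseCMLocusIsDense`): a set `Λ` of
CM points Zariski-dense on points makes the CM locus Zariski-dense, AO⁺ makes it dense, so the family is a printed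
one at any point of `Λ` (non-empty: `nonempty_of_zariskiClosureOnPoints_eq_univ`), and IC_MT spreads algebraicity
from that point. WITHOUT AO⁺ no edge between IC_MT and S_ZD is claimed (IC_MT needs analytic density, S_ZD offers
Zariski density). [cite: Pila2022, Conj. 6.4 and Thm. 6.6] [cite: Abdulali1994FamiliesAV, (1.1) (p. 1122)] -/
theorem spreadFromZariskiDenseCMPoints_of_aoDense_of_invariantCyclesOnMTFamilies
    (hAO : ZariskiDenseCMLocusIsDense)
    (hIC : (∀ (A : AbelianVariety ℂ) (p : ℕ) (c : complexBetti A.X (2 * p)) (𝒳 S : SchemeOver ℂ) (f : 𝒳 ⟶ S),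
      IsCMDenseMumfordTateFamilyFor A p c f → InvariantCyclesHoldFor f A.dim)) :
    SpreadFromZariskiDenseCMPoints := by
  intro n 𝒳 S f hf h𝒳 hS hirr hsm hab p W hW Λ hΛcm hΛ hΛalg t
  have hD : Dense (cmLocus f n) :=
    hAO f hf h𝒳 hS hirr hsm hab (AbelianAll.zariskiClosureOnPoints_eq_univ_mono hΛ hΛcm)
  obtain ⟨s₀, hs₀⟩ := AbelianAll.nonempty_of_zariskiClosureOnPoints_eq_univ hΛ t
  obtain ⟨A₀, ⟨e₀⟩, hdim₀, -⟩ := hΛcm hs₀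
  subst hdim₀
  have hfam : IsCMDenseMumfordTateFamilyFor A₀ p
      (complexBetti.map e₀.hom (2 * p) (complexBetti.map (fiberι f s₀) (2 * p) W)) f :=
    ⟨s₀, e₀, W, hf, h𝒳, hS, hirr, hsm, hab, hW, rfl, hD⟩
  exact hIC A₀ p _ 𝒳 S f hfam p W hW ⟨s₀, hΛalg s₀ hs₀⟩ t

/-- **KIND-1 row for IC_MT in the kernel** (table, `CMIdle` column): granted AO⁺, `hF`, André 1992 and spread-1's
densely-anchored Weil-family inputs, `HC_CM` is IDLE next to IC_MT (through `IC_MT ⟹ S_ZD` and spread III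
`cmIdle_spreadZD`) — the kernel shadow of Abdulali's printed Thm. 6.1 (a). H4 and U stay NOT idle in any known
sense. [cite: Abdulali1994FamiliesAV, Thm. 6.1 (a)] [cite: Deligne1982HodgeCycles, Thm. 4.8 (pp. 50–51)] -/
theorem cmIdle_invariantCyclesOnMTFamilies_of_aoDense_of_denselyAnchored (hAO : ZariskiDenseCMLocusIsDense)
    (hF : deligne1982_cmDenseMumfordTateFamilies)
    (h𝔄 : Andre1992_hodgeClasses_cmAbelianVariety_mem_span_pullback_weilClasses)
    (hDq : DenselyAnchoredWeilFamiliesImaginaryQuadratic) (hDcm : DenselyAnchoredWeilFamiliesCMField) :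
    CMIdle
      (∀ (A : AbelianVariety ℂ) (p : ℕ) (c : complexBetti A.X (2 * p)) (𝒳 S : SchemeOver ℂ) (f : 𝒳 ⟶ S),
        IsCMDenseMumfordTateFamilyFor A p c f → InvariantCyclesHoldFor f A.dim) :=
  cmIdle_antitone (spreadFromZariskiDenseCMPoints_of_aoDense_of_invariantCyclesOnMTFamilies hAO)
    (AbelianAll.cmIdle_spreadZD hF h𝔄 hDq hDcm)

/-- **The Mumford–Tate branch of the deformation axis, strongest to weakest, every arrow landed**:
`IC_MT ⟹ H4` and `IC_MT ⟹[AO⁺] S_ZD` (this part), `(1) ⟹ H4`, `H4 ⟹ U ⟺ (∀ A, CMSpreadingAt A)`, `H4 ⟹ CMToAbelian`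
mod `hF` (`(1) ⟹ IC_MT` and `IC_MT ⟹ U` are III by name; the spread-1 chain `(1) ⟹ S_ZD ⟹ U_Z ⟹ U ⟹[hF] CMToAbelian`
is frame II `ladder_spreadAxis`). No converse is claimed. [cite: CharlesSchnell2014Notes, Conj. 11.3.1, Prop. 11.3.11
and Thm. 11.5.11] [cite: Abdulali1994FamiliesAV, (1.1) and Lemma 6.2] -/
theorem ladder_mumfordTateBranch (hF : deligne1982_cmDenseMumfordTateFamilies) :
    ((∀ (A : AbelianVariety ℂ) (p : ℕ) (c : complexBetti A.X (2 * p)) (𝒳 S : SchemeOver ℂ) (f : 𝒳 ⟶ S),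
        IsCMDenseMumfordTateFamilyFor A p c f → InvariantCyclesHoldFor f A.dim) →
      AlgebraicityLocusClosedOnCMDenseFamilies ∧ (ZariskiDenseCMLocusIsDense → SpreadFromZariskiDenseCMPoints)) ∧
      (AbelianSchemeVHC → AlgebraicityLocusClosedOnCMDenseFamilies) ∧
      (AlgebraicityLocusClosedOnCMDenseFamilies → UniformAlgebraicityAtCMPoints) ∧
      (UniformAlgebraicityAtCMPoints ↔ ∀ A : AbelianVariety ℂ, CMSpreadingAt A) ∧
      (AlgebraicityLocusClosedOnCMDenseFamilies → CMToAbelian) :=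
  ⟨fun hIC ↦ ⟨algebraicityLocusClosedOnCMDenseFamilies_of_invariantCyclesOnMTFamilies hIC,
      fun hAO ↦ spreadFromZariskiDenseCMPoints_of_aoDense_of_invariantCyclesOnMTFamilies hAO hIC⟩,
    algebraicityLocusClosedOnCMDenseFamilies_of_abelianSchemeVHC,
    uniformAlgebraicityAtCMPoints_of_locusClosed, uniformAlgebraicityAtCMPoints_iff_forall_cmSpreadingAt,
    fun h4 ↦ cmToAbelian_of_closesWithCM (AbelianAll.closesWithCM_spreadAxis hF).2.2
      (uniformAlgebraicityAtCMPoints_of_locusClosed h4)⟩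

/-- **Collapse modulo `HC_CM` ALONE (no print)**: under `HC_CM` the three ALL-fibre nodes IC_MT, H4, U coincide
(`U ⟹ IC_MT` is III `invariantCyclesOnMTFamilies_of_HC_CM_of_uniform`, `IC_MT ⟺ U` mod `HC_CM` is III
`invariantCyclesOnMTFamilies_iff_uniform_of_HC_CM`; the other arrows are unconditional). This sharpens spread III
`locusClosed_collapse_of_HC_CM` (first conjunct), which needed `hF` as well; S_ZD / U_Z join the collapse only
modulo `hF` (frame II) or AO⁺. [cite: Abdulali1994FamiliesAV, (1.1) and Lemma 6.2] [cite: CharlesSchnell2014Notes, Prop. 11.3.11] -/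
theorem mumfordTateBranch_collapse_of_HC_CM (hCM : CMAbelianHodge) :
    ((∀ (A : AbelianVariety ℂ) (p : ℕ) (c : complexBetti A.X (2 * p)) (𝒳 S : SchemeOver ℂ) (f : 𝒳 ⟶ S),
      IsCMDenseMumfordTateFamilyFor A p c f → InvariantCyclesHoldFor f A.dim) ↔
      AlgebraicityLocusClosedOnCMDenseFamilies) ∧
      (AlgebraicityLocusClosedOnCMDenseFamilies ↔ UniformAlgebraicityAtCMPoints) :=
  have hIU := invariantCyclesOnMTFamilies_iff_uniform_of_HC_CM hCM
  ⟨⟨algebraicityLocusClosedOnCMDenseFamilies_of_invariantCyclesOnMTFamilies,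
      fun h4 ↦ hIU.2 (uniformAlgebraicityAtCMPoints_of_locusClosed h4)⟩,
    ⟨uniformAlgebraicityAtCMPoints_of_locusClosed,
      fun hU ↦ algebraicityLocusClosedOnCMDenseFamilies_of_invariantCyclesOnMTFamilies (hIU.2 hU)⟩⟩

/-! ## §C The pencil branch: the `CMIdle` bit of the CM-localised nodes (3), (R631), modulo the junction `J₂₂⁺` -/

/-! `J₂₂⁺` (the hypothesis `h₂₂` below) = part VI's displayed junction, VERBATIM (André 1996 Lemmes 6.3.2–6.3.3 in
the rendering of fact 22 with the two printed clauses RETAINED: the 6.3.3 pencil carrying `w` has a CM fibre and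
relative dimension `2·dim A'`). A THEOREM in print; not formalised; a binder, never a fact; displayed inline (no
`def`, no notation). [cite: Andre1996Motifs, Lemmes 6.3.2–6.3.3 (pp. 32–33)] -/

/-- **KIND 1 in the kernel for the CM-localised pencil nodes**: granted Lemme 6.3.1 (`h₂₁`) and the junction `J₂₂⁺`
(`h₂₂`, displayed), `HC_CM` is IDLE next to (R631) `CMAnchoredPencilVHC`, (3) `CMPointedCompactPencilVHC` and the
sub-cell's (3) `AbelianAll.CMPointedPencilVHC` (the same statement, XIII `cmPointedPencilVHC_iff_cmPointedCompactPencilVHC`;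
COUNT ONCE) — VI `HC_AV_of_andre1996_of_junction_of_cmAnchoredPencilVHC` placed in the grammar; frame I's table entry
"(3) · CMIdle: only mod deform VI's junction (not restated)" is hereby restated by name.
[cite: Andre1996Motifs, §6.3 (pp. 31–33)] [cite: Milne2020HodgeClassesAV, Rem. 2–3] -/
theorem cmIdle_cmLocalisedPencils_of_andre1996_of_junction (h₂₁ : andre1996_cmAnchoredPencil)
    (h₂₂ : ∀ (B : AbelianVariety ℂ), IsSmoothProjective B.dim B.X → IsOfCMType B →
      ∀ (p : ℕ), 1 < p → ∀ (c : complexBetti B.X (2 * p)), IsRationalClass c →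
        IsOfHodgeType B.dim B.X (2 * p) p p c →
          c ∈ Submodule.span ℂ
            {c' : complexBetti B.X (2 * p) |
              ∃ (B' : AbelianVariety ℂ) (g : B ⟶ B') (w : complexBetti B'.X (2 * p)) (A' : AbelianVariety ℂ)
                (𝒳 S : SchemeOver ℂ) (f : 𝒳 ⟶ S),
                IsAlgebraicallyAnchoredPencilFor B' p w f (2 * A'.dim) ∧
                  (∃ (t : ComplexPoints S) (A₀ : AbelianVariety ℂ),
                    Nonempty (A₀.X ≅ fiberOver f t) ∧ IsOfCMType A₀) ∧
                  c' = complexBetti.map g.hom.hom.hom (2 * p) w}) :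
    CMIdle CMAnchoredPencilVHC ∧ CMIdle CMPointedCompactPencilVHC ∧ CMIdle AbelianAll.CMPointedPencilVHC :=
  have hR : CMIdle CMAnchoredPencilVHC :=
    fun h ↦ HC_AV_of_andre1996_of_junction_of_cmAnchoredPencilVHC h₂₁ h₂₂ h
  have h3 : CMIdle CMPointedCompactPencilVHC := cmIdle_antitone cmAnchoredPencilVHC_of_cmPointedCompactPencilVHC hR
  ⟨hR, h3, cmIdle_antitone cmPointedPencilVHC_iff_cmPointedCompactPencilVHC.1 h3⟩

/-! ## §P Pivot rows (frame III `PivotAV`): what joins the pivot tier, and under which inputs -/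

/-- **IC_MT is a PIVOT granted AO⁺, `hF`, André 1992, `DA_q`, `DA_K`** (§B `CMIdle` + §A `OnPathAV`); with frame III
`iff_of_pivotAV` and `pivotAV_spreadZD_of_denselyAnchored` this gives `IC_MT ↔ S_ZD ↔ (1) ↔ HC_AV` under those inputs
with NO `HC_CM` — the kernel form of Abdulali's Thm. 6.1 (a) row. [cite: Abdulali1994FamiliesAV, Thm. 6.1 (a)]
[cite: Pila2022, Conj. 6.4] -/
theorem pivotAV_invariantCyclesOnMTFamilies_of_aoDense_of_denselyAnchored (hAO : ZariskiDenseCMLocusIsDense)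
    (hF : deligne1982_cmDenseMumfordTateFamilies)
    (h𝔄 : Andre1992_hodgeClasses_cmAbelianVariety_mem_span_pullback_weilClasses)
    (hDq : DenselyAnchoredWeilFamiliesImaginaryQuadratic) (hDcm : DenselyAnchoredWeilFamiliesCMField) :
    PivotAV
      (∀ (A : AbelianVariety ℂ) (p : ℕ) (c : complexBetti A.X (2 * p)) (𝒳 S : SchemeOver ℂ) (f : 𝒳 ⟶ S),
        IsCMDenseMumfordTateFamilyFor A p c f → InvariantCyclesHoldFor f A.dim) :=
  ⟨cmIdle_invariantCyclesOnMTFamilies_of_aoDense_of_denselyAnchored hAO hF h𝔄 hDq hDcm,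
    onPathAV_invariantCyclesOnMTFamilies⟩

/-- (1) is a pivot by a THIRD input set (§A `cmIdle_abelianSchemeVHC_of_milne`; frame III has it mod `h₂₁ h₂₂` and mod
`hF h𝔄 DA_q DA_K`). [cite: Deligne1982HodgeCycles, Milne 2003 re-edition endnote 19] [cite: Andre1992HodgeCM] -/
theorem pivotAV_abelianSchemeVHC_of_milne
    (h𝔄 : Andre1992_hodgeClasses_cmAbelianVariety_mem_span_pullback_weilClasses)
    (hD : deligne1982_weilFamily_hodgeWeilSection_all) (hanc : AnchoredWeilFamiliesCMField)
    (h₁₄ : deligne1982_exists_cmAnchoredHodgeFamily) : PivotAV AbelianSchemeVHC :=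
  ⟨cmIdle_abelianSchemeVHC_of_milne h𝔄 hD hanc h₁₄, AbelianAll.onPathAV_abelianSchemeVHC_and_compactAbelianPencilVHC.1⟩

/-- **The CM-localised pencil nodes leave frame III's complement tier whenever (R631) is CM-idle** — e.g. granted
`h₂₁ ∧ J₂₂⁺` (§C, first conjunct): then (R631), (3) and the sub-cell's (3) are PIVOTS (on-path: VI
`cmAnchoredPencilVHC_of_HC_AV`, `cmPointedCompactPencilVHC_of_HC_AV`, XIII's iff), hence by frame III `iff_of_pivotAV`
and `pivotAV_pencilTop_of_andre1996` ONE statement with (2) and (1), no `HC_CM`. [cite: Andre1996Motifs, §6.3 (pp. 31–33)] -/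
theorem pivotAV_cmLocalisedPencils_of_cmIdle (h : CMIdle CMAnchoredPencilVHC) :
    PivotAV CMAnchoredPencilVHC ∧ PivotAV CMPointedCompactPencilVHC ∧ PivotAV AbelianAll.CMPointedPencilVHC :=
  have h3 : CMIdle CMPointedCompactPencilVHC := cmIdle_antitone cmAnchoredPencilVHC_of_cmPointedCompactPencilVHC h
  ⟨⟨h, cmAnchoredPencilVHC_of_HC_AV⟩, ⟨h3, cmPointedCompactPencilVHC_of_HC_AV⟩,
    ⟨cmIdle_antitone cmPointedPencilVHC_iff_cmPointedCompactPencilVHC.1 h3,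
      fun hAV ↦ cmPointedPencilVHC_iff_cmPointedCompactPencilVHC.2 (cmPointedCompactPencilVHC_of_HC_AV hAV)⟩⟩

/-! ## §D The binder itself: `HC_CM` cut down to codimension two (Hazama 2003), in every row of the frame -/

/-- **`HC_CM ↔ ∀ B, HC^{(2)}(B)` for CM abelian varieties `B`**, granted Hazama's record (the consequence lane's
`cmHodgeHypothesis_iff_codimTwo`, composed with the tree's unfolding `Ring2Transport.HC_CM_iff_forall_cmHodgeHypothesisAt`).
[cite: Hazama2003GHCCM, Thm. 8.3 p. 655] [cite: Milne1999, §7 (H)] -/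
theorem HC_CM_iff_forall_codimTwo_of_hazama2003 (h83 : Hazama2003_generalHodge_cmType_of_hodge_codimTwo) :
    CMAbelianHodge ↔ ∀ B : AbelianVariety ℂ, CMHodgeCodimTwoHypothesisAt B :=
  Ring2Transport.HC_CM_iff_forall_cmHodgeHypothesisAt.trans (cmHodgeHypothesis_iff_codimTwo h83)

/-- Hence in EVERY row of the frame the binder may be read as codimension-two Hodge classes on CM abelian
varieties: `ClosesWithCM B ↔ (HC_CM^{(2)} → B → HC_AV)`, granted `h83`. [cite: Hazama2003GHCCM, Thm. 8.3 p. 655] -/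
theorem closesWithCM_iff_codimTwo_of_hazama2003 (h83 : Hazama2003_generalHodge_cmType_of_hodge_codimTwo)
    {B : Prop} :
    ClosesWithCM B ↔ ((∀ B' : AbelianVariety ℂ, CMHodgeCodimTwoHypothesisAt B') → B → HodgeAbelianVarieties) :=
  ⟨fun h h2 hB ↦ h ((HC_CM_iff_forall_codimTwo_of_hazama2003 h83).2 h2) hB,
    fun h hCM hB ↦ h ((HC_CM_iff_forall_codimTwo_of_hazama2003 h83).1 hCM) hB⟩

/-- The two fact-light rows with the smaller binder: granted Hazama's record, codimension-two Hodge on CM abelian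
varieties plus CPS_∃ (NO further fact), resp. plus U (mod `hF`), gives `HC_AV`. CONDITIONAL on two OPEN statements
each; nothing is decided. [cite: Hazama2003GHCCM, Thm. 8.3 p. 655] [cite: Andre1996Motifs, §6.3 a) (p. 33)]
[cite: CharlesSchnell2014Notes, Thm. 11.5.11] -/
theorem HC_AV_of_hazama2003_of_codimTwo_of_weakestNodes (h83 : Hazama2003_generalHodge_cmType_of_hodge_codimTwo)
    (h2 : ∀ B : AbelianVariety ℂ, CMHodgeCodimTwoHypothesisAt B) :
    (CMAnchoredPencilCMSpreading → HodgeAbelianVarieties) ∧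
      (deligne1982_cmDenseMumfordTateFamilies → UniformAlgebraicityAtCMPoints → HodgeAbelianVarieties) :=
  ⟨(closesWithCM_iff_codimTwo_of_hazama2003 h83).1 AbelianAll.closesWithCM_cmAnchoredPencilCMSpreading h2,
    fun hF ↦ (closesWithCM_iff_codimTwo_of_hazama2003 h83).1 (AbelianAll.closesWithCM_spreadAxis hF).2.2 h2⟩

/-! ## Audit
Every theorem above has an OPEN statement (`HC_CM` inside a grammar word or as `hCM`, a node, AO⁺, `DA_q`/`DA_K`,
R3anc, `J₂₂⁺`, `h2`) among its hypotheses or inside its conclusion's predicate; IC_MT and `J₂₂⁺` are displayed `Prop`s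
written inline, not declarations; no fact of this cell is cited. Nothing is decided (`HC_CM`, `HC_AV`, the item, any node). -/

/-- On-path audit of this part: the summit gives IC_MT, H4 and the localised U outright (through `HC_AV`); the
idle-making inputs AO⁺, R3anc, `J₂₂⁺` are NOT claimed on-path. [folklore] -/
theorem frameRows_of_hodgeConjecture (hHC : _root_.HodgeConjecture) :
    (∀ (A : AbelianVariety ℂ) (p : ℕ) (c : complexBetti A.X (2 * p)) (𝒳 S : SchemeOver ℂ) (f : 𝒳 ⟶ S),
      IsCMDenseMumfordTateFamilyFor A p c f → InvariantCyclesHoldFor f A.dim) ∧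
      AlgebraicityLocusClosedOnCMDenseFamilies ∧ (∀ A : AbelianVariety ℂ, CMSpreadingAt A) :=
  ⟨of_onPathAV_of_hodgeConjecture onPathAV_invariantCyclesOnMTFamilies hHC,
    of_onPathAV_of_hodgeConjecture AbelianAll.onPathAV_locusClosed hHC,
    of_onPathAV_of_hodgeConjecture onPathAV_forall_cmSpreadingAt hHC⟩

end Summit.HodgeConjecture.HodgeConjecture.Ring2.Deform

end
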